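import Literature.CategoryTheory.Preadditive.KrullSchmidtObjects
import HarnessLib

/-!
# Direct summands of Krull–Schmidt objects are partial sums (Krause, Cor. 4.3)

Topic `Literature/CategoryTheory/Preadditive`, namespace `Literature.CategoryTheory.KrullSchmidt`; sequel of `KrullSchmidtObjects` (seat p39
g37-#10: an object `X ≅ ⨁ⱼ Xⱼ` with local `End Xⱼ` has semiperfect `End X`; Krull–Schmidt objects cancel), `KrullSchmidtSemiperfect` (g37-#2:
retracts keep `End` semiperfect; objects with semiperfect `End` decompose into indecomposables with local `End`), `KrullSchmidtUniqueness`
(p39 g36-#15: Krause Thm. 4.2 `exists_equiv_iso_of_iso_biproduct`) and `IndecomposableLocalEnd` (g36: split idempotents give binary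
biproduct decompositions).

Krause [Krause2015KS], **Corollary 4.3.** «Let `X` be an object of a Krull-Schmidt category and suppose there are two decompositions
`X₁ ⊕ … ⊕ Xₙ = X = X′ ⊕ X″` such that each `Xᵢ` is indecomposable. Then there exists an integer `t ≤ n` such that
`X = X₁ ⊕ … ⊕ X_t ⊕ X′` after reindexing the `Xᵢ`.»  Proof: «Let `X′ = Y₁ ⊕ … ⊕ Y_s` and `X″ = Z₁ ⊕ … ⊕ Z_t` be decompositions into
indecomposable objects. It follows from the uniqueness of these decompositions that `n = s + t` and that `X″ ≅ X₁ ⊕ … ⊕ X_t` after some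
reindexing of the `Xᵢ`.»  We prove exactly the quoted consequence, object-wise (for ONE Krull–Schmidt object `X`, in an idempotent-complete
preadditive category with finite biproducts): **both `X′` and `X″` are biproducts of complementary subfamilies of `(Xⱼ)`**; and the
retract form: every direct summand `Y` of `X` (`Y →ι X →π Y`, `ιπ = 1`) is a partial sum `⨁_{j ∈ T} Xⱼ`.

## What is formalised

* §1 plumbing: `nonempty_biprod_biproduct_iso_biproduct_sum_elim` (`(⨁ f) ⊞ (⨁ g) ≅ ⨁ Sum.elim f g`),
  `nonempty_iso_biproduct_sum_elim_of_iso_biprod`; `exists_iso_biprod_of_split` (a retract is a binary biproduct summand).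
* §2 **`exists_iso_biproduct_subtype_of_iso_biprod`** (Krause 4.3: `X ≅ ⨁ⱼ Xⱼ` local-`End`, `X ≅ X′ ⊞ X″` ⟹ `X″ ≅ ⨁_{p j} Xⱼ` and
  `X′ ≅ ⨁_{¬ p j} Xⱼ` for a predicate `p` on the indices), **`exists_iso_biproduct_subtype_of_split`** (retract form),
  `exists_iso_biproduct_isLocalRing_end_of_split` (direct summands of Krull–Schmidt objects are Krull–Schmidt objects), and the count
  `card_add_card_eq_of_iso_biprod` (`n = s + t`).

Theorems only (isomorphisms recorded as `Nonempty`∕`∃`), 0 `sorry`, no definition, no named fact (net debt 0, D-0026); no instance, no notation.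

## Mathlib / Literature search

Mathlib: `biprod.desc ∕ lift`, `biproduct.desc ∕ ι ∕ whiskerEquiv ∕ mapIso`, `biprod.hom_ext'`, `biproduct.hom_ext'`, `Equiv.ofBijective`,
`eqToIso`; no `(⨁ f) ⊞ (⨁ g) ≅ ⨁ Sum.elim f g` found (`rg "Sum.elim" Mathlib/CategoryTheory/Limits/Shapes/Biproducts.lean` → 0).  Literature:
`rg "Sum.elim|Subtype.restrict" lean/Literature/CategoryTheory` → 0; g36 `exists_iso_biprod_of_idempotent` is the model for §1's retract lemma.

## References

* H. Krause, *Krull–Schmidt categories and projective covers*, Expo. Math. 33 (2015): Thm. 4.2, Cor. 4.3, Cor. 4.4. [Krause2015KS]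
* T. Y. Lam, *A First Course in Noncommutative Rings*, 2nd ed. (2001): §19 Cor. (19.22); §23 Thm. (23.6), (23.8). [Lam2001FirstCourse]
* A. Shah, *Krull–Remak–Schmidt decompositions in Hom-finite additive categories*, Expo. Math. 41 (2023): Prop. 3.11. [Shah2023KRS]

## Provenance

Lane `lit-hodgefound` (summit `HodgeConjecture`, Track 2 foundations library), seat `lit-hodgefound-p39` (literature-prover, generation 37,
row g37-#11); Krause materialised as paper-arxiv-1410.2822 (p0008).
-/

open CategoryTheory CategoryTheory.Limits

namespace Literature.CategoryTheory.KrullSchmidt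

open Literature.RingTheory.Idempotents (IsSemiperfectRing)

universe v u

variable {C : Type u} [Category.{v} C] [Preadditive C]

/-! ## §1 Plumbing: sums of biproducts, retracts as biproduct summands -/

section Plumbing

variable [HasFiniteBiproducts C]

/-- `(⨁ f) ⊞ (⨁ g) ≅ ⨁_{ι ⊕ κ} (f, g)`. [cite: Krause2015KS, §2 (finite biproducts), Cor. 4.3 (proof)] -/
theorem nonempty_biprod_biproduct_iso_biproduct_sum_elim [HasBinaryBiproducts C] {ι κ : Type} [Fintype ι] [Fintype κ] (f : ι → C)
    (g : κ → C) : Nonempty ((⨁ f) ⊞ (⨁ g) ≅ ⨁ (fun s : ι ⊕ κ => Sum.elim f g s)) := by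
  classical
  refine ⟨{ hom := biprod.desc (biproduct.desc fun j => biproduct.ι (fun s : ι ⊕ κ => Sum.elim f g s) (Sum.inl j))
              (biproduct.desc fun k => biproduct.ι (fun s : ι ⊕ κ => Sum.elim f g s) (Sum.inr k))
            inv := biproduct.desc fun s => match s with
              | Sum.inl j => (biproduct.ι f j ≫ biprod.inl : f j ⟶ (⨁ f) ⊞ (⨁ g))
              | Sum.inr k => (biproduct.ι g k ≫ biprod.inr : g k ⟶ (⨁ f) ⊞ (⨁ g))
            hom_inv_id := ?_
            inv_hom_id := ?_ }⟩
  · apply biprod.hom_ext'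
    · apply biproduct.hom_ext'
      intro j
      rw [biprod.inl_desc_assoc, biproduct.ι_desc_assoc, Category.comp_id]
      erw [biproduct.ι_desc]
    · apply biproduct.hom_ext'
      intro k
      rw [biprod.inr_desc_assoc, biproduct.ι_desc_assoc, Category.comp_id]
      erw [biproduct.ι_desc]
  · apply biproduct.hom_ext'
    rintro (j | k)
    · erw [biproduct.ι_desc_assoc, Category.assoc, biprod.inl_desc, biproduct.ι_desc, Category.comp_id]
    · erw [biproduct.ι_desc_assoc, Category.assoc, biprod.inr_desc, biproduct.ι_desc, Category.comp_id]

/-- `X ≅ X′ ⊞ X″`, `X′ ≅ ⨁ Ys`, `X″ ≅ ⨁ Zs` ⟹ `X ≅ ⨁_{ι ⊕ κ} (Ys, Zs)`. [cite: Krause2015KS, Cor. 4.3 (proof)] -/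
theorem nonempty_iso_biproduct_sum_elim_of_iso_biprod [HasBinaryBiproducts C] {X X' X'' : C} {ι κ : Type} [Fintype ι] [Fintype κ]
    {Ys : ι → C} {Zs : κ → C} (i : X ≅ X' ⊞ X'') (iY : X' ≅ ⨁ Ys) (iZ : X'' ≅ ⨁ Zs) :
    Nonempty (X ≅ ⨁ (fun s : ι ⊕ κ => Sum.elim Ys Zs s)) := by
  obtain ⟨e⟩ := nonempty_biprod_biproduct_iso_biproduct_sum_elim Ys Zs
  exact ⟨i ≪≫ biprod.mapIso iY iZ ≪≫ e⟩

omit [HasFiniteBiproducts C] in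
/-- **A retract is a direct summand**: in an idempotent-complete preadditive category a split pair `Y →ι X →π Y` (`ιπ = 1`) extends to
`X ≅ Y ⊞ Z` (split the complementary idempotent `1 − πι`; Shah Prop. 3.11). [cite: Shah2023KRS, Prop. 3.11, Def. 3.8] -/
theorem exists_iso_biprod_of_split [HasBinaryBiproducts C] [IsIdempotentComplete C] {X Y : C} (ι : Y ⟶ X) (π : X ⟶ Y)
    (hιπ : ι ≫ π = 𝟙 Y) : ∃ (Z : C) (i : X ≅ Y ⊞ Z), i.hom ≫ biprod.fst = π ∧ biprod.inl ≫ i.inv = ι := by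
  have hp : (π ≫ ι) ≫ (π ≫ ι) = π ≫ ι := by rw [Category.assoc, reassoc_of% hιπ]
  have hq : (𝟙 X - π ≫ ι) ≫ (𝟙 X - π ≫ ι) = 𝟙 X - π ≫ ι := by
    simp only [Preadditive.sub_comp, Preadditive.comp_sub, Category.id_comp, Category.comp_id, hp, sub_self, sub_zero]
  obtain ⟨Z, ι', π', hιπ', hπι'⟩ := IsIdempotentComplete.idempotents_split X (𝟙 X - π ≫ ι) hq
  have h1' : ι' ≫ (𝟙 X - π ≫ ι) = ι' := by rw [← hπι', ← Category.assoc, hιπ', Category.id_comp]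
  have hιπ'0 : ι ≫ π' = 0 := by
    calc ι ≫ π' = ι ≫ (π' ≫ ι') ≫ π' := by rw [Category.assoc, hιπ', Category.comp_id]
      _ = ι ≫ (𝟙 X - π ≫ ι) ≫ π' := by rw [hπι']
      _ = 0 := by rw [Preadditive.sub_comp, Category.id_comp, Preadditive.comp_sub, Category.assoc, reassoc_of% hιπ, sub_self]
  have hι'π0 : ι' ≫ π = 0 := by
    have h2 : ι' ≫ π ≫ ι = 0 := by
      have := h1'
      rw [Preadditive.comp_sub, Category.comp_id, sub_eq_self] at this
      exact this
    calc ι' ≫ π = (ι' ≫ π ≫ ι) ≫ π := by rw [Category.assoc, Category.assoc, hιπ, Category.comp_id]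
      _ = 0 := by rw [h2, zero_comp]
  refine ⟨Z, ⟨biprod.lift π π', biprod.desc ι ι', ?_, ?_⟩, biprod.lift_fst _ _, biprod.inl_desc _ _⟩
  · rw [biprod.lift_desc, hπι', add_sub_cancel]
  · ext <;> simp [hιπ, hιπ', hιπ'0, hι'π0]

end Plumbing

/-! ## §2 Krause Cor. 4.3: direct summands of a Krull–Schmidt object are partial sums -/

section Summands

variable [HasFiniteBiproducts C] [HasBinaryBiproducts C] [IsIdempotentComplete C] {X : C} {ι : Type} [Fintype ι] {Xs : ι → C}

/-- **KRAUSE COR. 4.3 (object-wise): if `X ≅ ⨁ⱼ Xⱼ` with all `End Xⱼ` local and `X ≅ X′ ⊞ X″`, then — after reindexing — `X″` is the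
sum of some of the `Xⱼ` and `X′` the sum of the others**: there is a predicate `p` on the indices with `X″ ≅ ⨁_{p j} Xⱼ` and
`X′ ≅ ⨁_{¬ p j} Xⱼ`.  («It follows from the uniqueness of these decompositions that `n = s + t` and that `X″ ≅ X₁ ⊕ … ⊕ X_t` after some
reindexing of the `Xᵢ`.») [cite: Krause2015KS, Cor. 4.3, Thm. 4.2, Cor. 4.4] [cite: Lam2001FirstCourse, §23 Thm. (23.6), Thm. (23.8)] -/
theorem exists_iso_biproduct_subtype_of_iso_biprod (i₁ : X ≅ ⨁ Xs) (h : ∀ j, IsLocalRing (End (Xs j))) {X' X'' : C}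
    (i₂ : X ≅ X' ⊞ X'') :
    ∃ (p : ι → Prop) (_ : DecidablePred p), Nonempty (X'' ≅ ⨁ (fun j : {j // p j} => Xs j.1)) ∧
      Nonempty (X' ≅ ⨁ (fun j : {j // ¬ p j} => Xs j.1)) := by
  classical
  haveI := isSemiperfectRing_end_of_iso_biproduct_isLocalRing_end i₁ h
  haveI := isSemiperfectRing_end_of_iso_biprod_left i₂
  haveI := isSemiperfectRing_end_of_iso_biprod_right i₂
  -- decompose the two summands into indecomposables with local endomorphism rings
  obtain ⟨r, Ys, ⟨iY⟩, hY⟩ := exists_iso_biproduct_isLocalRing_end_of_isSemiperfectRing X'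
  obtain ⟨s, Zs, ⟨iZ⟩, hZ⟩ := exists_iso_biproduct_isLocalRing_end_of_isSemiperfectRing X''
  obtain ⟨i₃⟩ := nonempty_iso_biproduct_sum_elim_of_iso_biprod i₂ iY iZ
  -- Krull–Schmidt: `Xs j ≅ (Ys, Zs) (σ j)` for a bijection `σ : ι ≃ Fin r ⊕ Fin s`
  obtain ⟨σ, hσ⟩ := exists_equiv_iso_of_iso_biproduct i₁ i₃ h (by rintro (k | k); exacts [hY k, hZ k])
  refine ⟨fun j => ∃ k, σ j = Sum.inr k, inferInstance, ?_, ?_⟩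
  · -- `X″ ≅ ⨁ Zs ≅ ⨁_{σ j ∈ inr} Xs j`
    have hinj : Function.Injective fun k : Fin s => (⟨σ.symm (Sum.inr k), k, σ.apply_symm_apply _⟩ : {j // ∃ k, σ j = Sum.inr k}) :=
      fun k l hkl => Sum.inr_injective (σ.symm.injective (congrArg Subtype.val hkl))
    have hsurj : Function.Surjective fun k : Fin s => (⟨σ.symm (Sum.inr k), k, σ.apply_symm_apply _⟩ : {j // ∃ k, σ j = Sum.inr k}) := by
      rintro ⟨j, k, hk⟩
      exact ⟨k, Subtype.ext (by simp only; rw [← hk, Equiv.symm_apply_apply])⟩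
    have w : ∀ k : Fin s, (fun j : {j // ∃ k, σ j = Sum.inr k} => Xs j.1) (Equiv.ofBijective _ ⟨hinj, hsurj⟩ k) ≅ Zs k := fun k =>
      Classical.choice (hσ (σ.symm (Sum.inr k))) ≪≫ eqToIso (by rw [Equiv.apply_symm_apply]; rfl)
    exact ⟨iZ ≪≫ biproduct.whiskerEquiv (Equiv.ofBijective _ ⟨hinj, hsurj⟩) w⟩
  · -- `X′ ≅ ⨁ Ys ≅ ⨁_{σ j ∈ inl} Xs j`
    have hnot : ∀ k : Fin r, ¬ ∃ l, σ (σ.symm (Sum.inl k)) = Sum.inr l := fun k ⟨l, hl⟩ => by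
      rw [Equiv.apply_symm_apply] at hl
      exact Sum.inl_ne_inr hl
    have hinj : Function.Injective fun k : Fin r => (⟨σ.symm (Sum.inl k), hnot k⟩ : {j // ¬ ∃ k, σ j = Sum.inr k}) :=
      fun k l hkl => Sum.inl_injective (σ.symm.injective (congrArg Subtype.val hkl))
    have hsurj : Function.Surjective fun k : Fin r => (⟨σ.symm (Sum.inl k), hnot k⟩ : {j // ¬ ∃ k, σ j = Sum.inr k}) := by
      rintro ⟨j, hj⟩
      rcases hσj : σ j with k | l
      · exact ⟨k, Subtype.ext (by simp only; rw [← hσj, Equiv.symm_apply_apply])⟩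
      · exact absurd ⟨l, hσj⟩ hj
    have w : ∀ k : Fin r, (fun j : {j // ¬ ∃ k, σ j = Sum.inr k} => Xs j.1) (Equiv.ofBijective _ ⟨hinj, hsurj⟩ k) ≅ Ys k := fun k =>
      Classical.choice (hσ (σ.symm (Sum.inl k))) ≪≫ eqToIso (by rw [Equiv.apply_symm_apply]; rfl)
    exact ⟨iY ≪≫ biproduct.whiskerEquiv (Equiv.ofBijective _ ⟨hinj, hsurj⟩) w⟩

/-- **Every direct summand of a Krull–Schmidt object is a partial sum**: if `X ≅ ⨁ⱼ Xⱼ` with local `End Xⱼ` and `Y →ι X →π Y` is a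
retract (`ιπ = 1`), then `Y ≅ ⨁_{j ∈ T} Xⱼ` for some set `T` of indices (the complement summand is the sum of the remaining `Xⱼ`).
[cite: Krause2015KS, Cor. 4.3, Cor. 4.4] [cite: Shah2023KRS, Prop. 3.11] -/
theorem exists_iso_biproduct_subtype_of_split (i₁ : X ≅ ⨁ Xs) (h : ∀ j, IsLocalRing (End (Xs j))) {Y : C} (ι' : Y ⟶ X) (π : X ⟶ Y)
    (hιπ : ι' ≫ π = 𝟙 Y) : ∃ (p : ι → Prop) (_ : DecidablePred p), Nonempty (Y ≅ ⨁ (fun j : {j // p j} => Xs j.1)) := by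
  obtain ⟨Z, i₂, -, -⟩ := exists_iso_biprod_of_split ι' π hιπ
  obtain ⟨p, hp, -, hY⟩ := exists_iso_biproduct_subtype_of_iso_biprod i₁ h i₂
  exact ⟨fun j => ¬ p j, inferInstance, hY⟩

omit [HasBinaryBiproducts C] in
/-- Direct summands of Krull–Schmidt objects are Krull–Schmidt objects: a retract of a finite sum of local-`End` objects is again a
finite sum of local-`End` objects (indeed of some of the same ones). [cite: Krause2015KS, Cor. 4.3, Cor. 4.4] -/
theorem exists_iso_biproduct_isLocalRing_end_of_split (i₁ : X ≅ ⨁ Xs) (h : ∀ j, IsLocalRing (End (Xs j))) {Y : C} (ι' : Y ⟶ X)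
    (π : X ⟶ Y) (hιπ : ι' ≫ π = 𝟙 Y) : ∃ (n : ℕ) (Ys : Fin n → C), Nonempty (Y ≅ ⨁ Ys) ∧ ∀ k, IsLocalRing (End (Ys k)) := by
  haveI := isSemiperfectRing_end_of_iso_biproduct_isLocalRing_end i₁ h
  haveI := isSemiperfectRing_end_of_split ι' π hιπ
  exact exists_iso_biproduct_isLocalRing_end_of_isSemiperfectRing Y

omit [IsIdempotentComplete C] in
/-- **`n = s + t`**: if `X ≅ ⨁ⱼ Xⱼ` (`ι` indices, local `End Xⱼ`) and `X ≅ X′ ⊞ X″` with `X′ ≅ ⨁_{κ} Yₖ`, `X″ ≅ ⨁_{μ} Zₗ` into objects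
with local endomorphism rings, then `|ι| = |κ| + |μ|`. [cite: Krause2015KS, Cor. 4.3 (proof: «`n = s + t`»), Thm. 4.2] -/
theorem card_eq_card_add_card_of_iso_biprod (i₁ : X ≅ ⨁ Xs) (h : ∀ j, IsLocalRing (End (Xs j))) {X' X'' : C} (i₂ : X ≅ X' ⊞ X'')
    {κ μ : Type} [Fintype κ] [Fintype μ] {Ys : κ → C} {Zs : μ → C} (iY : X' ≅ ⨁ Ys) (iZ : X'' ≅ ⨁ Zs)
    (hY : ∀ k, IsLocalRing (End (Ys k))) (hZ : ∀ l, IsLocalRing (End (Zs l))) :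
    Fintype.card ι = Fintype.card κ + Fintype.card μ := by
  classical
  obtain ⟨i₃⟩ := nonempty_iso_biproduct_sum_elim_of_iso_biprod i₂ iY iZ
  obtain ⟨σ, -⟩ := exists_equiv_iso_of_iso_biproduct i₁ i₃ h (by rintro (k | l); exacts [hY k, hZ l])
  rw [Fintype.card_congr σ, Fintype.card_sum]

end Summands

end Literature.CategoryTheory.KrullSchmidt
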